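import Mathlib
import Literature.NumberTheory.LFunctions.Zhang2022.Section16Eval1617
import HarnessLib

/-!
# Zhang (2022), §16 p. 95, "`𝓡₂ⱼ = −1/(β₁L′(1,χ)) + O(𝓛⁶)`" — preparatory sizes: `β₂`, `β₂ − β₁`,
# `P₄^{β₂−β₁} = −1 + O(𝓛⁻⁶)`, `ω₁(β₂−β₁) = 1 + O(α²𝓛⁻³⁰)`, and the numeric bookkeeping

Topic `Literature/NumberTheory/LFunctions/Zhang2022` (Landau–Siegel audit tree; verdict-neutral).
Y. Zhang, *Discrete mean estimates and the Landau–Siegel zero*, arXiv:2211.02515v1 (2022)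
[Zhang2022LandauSiegel] — **an unrefereed manuscript under adjudication**. Elementary inputs for the
"direct calculation" of §16 p. 95 (tex L4674–L4677, DAG `Z22:§16.u043`), all in the skeleton's
vocabulary: `beta_sizes` (`α ≤ |β₂| ≤ 3α`, `α/2 ≤ |β₂−β₁| ≤ 2α`, `|β₂ − 2β₁| = 12|c′|α²𝓛` for
`|c′|α𝓛 ≤ 1/14`), `log_P4` (`log P₄ = 𝓛⁹ − 2𝓛^{1.1} + 519 log 𝓛`), `norm_P4_cpow_add_one_le`
(`|P₄^{β₂−β₁} + 1| ≤ (521π + 3654π²|c′|)𝓛⁻⁶`), `norm_omega1_div_sub_inv_le`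
(`|ω₁(γ)/γ − 1/γ| ≤ (|γ|²/4𝓛³⁰)|γ|⁻¹`), and the small facts about `α = π𝓛⁻⁹` used to meet the
hypotheses of the cores (`alpha_le_pi_div`, `c_alpha_ell_small`, `alpha_small_rM`,
`lemma58_error_small`, `weight_error_small`). Consumed by `Section16RhoTwo`. Nothing of §16 is asserted here;
nothing about Theorems 1–2 of the source.

## References

* Y. Zhang, arXiv:2211.02515v1 (2022), §16 (16.11), p. 95; §2 (2.13), (2.21); §6 (`P₄ = PT⁻²t₀`);
  §4 (4.1). [cite: Zhang2022LandauSiegel, §16 p.95]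
-/

noncomputable section

open Complex Real Filter Topology

namespace Literature.NumberTheory.LFunctions.Zhang2022.Skeleton

/-! ## Sizes of `β₂`, `β₂ − β₁`, `β₂ − 2β₁` -/

section Sizes

variable (c' : ℝ) {D : ℕ}

/-- `β₂ = i·2α(1 + c′α𝓛)`, `β₂ − β₁ = i·α(1 + 7c′α𝓛)`, `β₂ − 2β₁ = i·12c′α²𝓛`.
[cite: Zhang2022LandauSiegel, §2 (2.13)] -/
theorem beta2_eq_I_mul (D : ℕ) :
    beta2 c' D = I * ((2 * alpha D * (1 + c' * alpha D * ell D) : ℝ) : ℂ) ∧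
    beta2 c' D - beta1 c' D = I * ((alpha D * (1 + 7 * c' * alpha D * ell D) : ℝ) : ℂ) ∧
    beta2 c' D - 2 * beta1 c' D = I * ((12 * c' * alpha D ^ 2 * ell D : ℝ) : ℂ) := by
  refine ⟨?_, ?_, ?_⟩ <;> · simp only [beta1, beta2]; push_cast; ring

/-- For `α ≥ 0` and `|c′|α𝓛 ≤ 1/14`: `α ≤ |β₂| ≤ 3α`, `α/2 ≤ |β₂ − β₁| ≤ 2α`, `|β₂ − 2β₁| = 12|c′|α²𝓛`.
[cite: Zhang2022LandauSiegel, §2 (2.13)] -/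
theorem beta_sizes (hα : 0 ≤ alpha D) (hαℓ : 0 ≤ alpha D * ell D)
    (h : |c'| * (alpha D * ell D) ≤ 1 / 14) :
    alpha D ≤ ‖beta2 c' D‖ ∧ ‖beta2 c' D‖ ≤ 3 * alpha D ∧
    alpha D / 2 ≤ ‖beta2 c' D - beta1 c' D‖ ∧ ‖beta2 c' D - beta1 c' D‖ ≤ 2 * alpha D ∧
    ‖beta2 c' D - 2 * beta1 c' D‖ ≤ 12 * |c'| * alpha D ^ 2 * ell D := by
  obtain ⟨h2, h21, h22⟩ := beta2_eq_I_mul c' D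
  have hc : |c' * alpha D * ell D| ≤ 1 / 14 := by
    rw [show c' * alpha D * ell D = c' * (alpha D * ell D) by ring, abs_mul, abs_of_nonneg hαℓ]
    exact h
  have hc1 := (abs_le.mp hc).1
  have hc2 := (abs_le.mp hc).2
  refine ⟨?_, ?_, ?_, ?_, ?_⟩
  · rw [h2, norm_mul, Complex.norm_I, one_mul, Complex.norm_real, Real.norm_eq_abs,
      abs_of_nonneg (by nlinarith)]
    nlinarith
  · rw [h2, norm_mul, Complex.norm_I, one_mul, Complex.norm_real, Real.norm_eq_abs,
      abs_of_nonneg (by nlinarith)]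
    nlinarith
  · rw [h21, norm_mul, Complex.norm_I, one_mul, Complex.norm_real, Real.norm_eq_abs,
      abs_of_nonneg (by nlinarith)]
    nlinarith
  · rw [h21, norm_mul, Complex.norm_I, one_mul, Complex.norm_real, Real.norm_eq_abs,
      abs_of_nonneg (by nlinarith)]
    nlinarith
  · rw [h22, norm_mul, Complex.norm_I, one_mul, Complex.norm_real, Real.norm_eq_abs,
      show (12 * c' * alpha D ^ 2 * ell D : ℝ) = 12 * (c' * (alpha D * (alpha D * ell D))) by ring,
      abs_mul, abs_mul, abs_mul, abs_of_nonneg hα, abs_of_nonneg hαℓ,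
      abs_of_pos (by norm_num : (0:ℝ) < 12)]
    nlinarith [abs_nonneg c']

end Sizes

/-! ## `P₄^{β₂−β₁} = −1 + O(𝓛⁻⁶)` and `ω₁(β₂−β₁) = 1 + O(α²𝓛⁻³⁰)` -/

section PowAndWeight

variable (c' : ℝ) {D : ℕ}

/-- For real `x > 0` and real `b, θ`: `‖x^{ib} − e^{iθ}‖ ≤ |b log x − θ|`. [folklore] -/
private theorem norm_cpow_I_mul_sub_exp_le {x : ℝ} (hx : 0 < x) (b θ : ℝ) :
    ‖(x : ℂ) ^ (I * b) - Complex.exp (θ * I)‖ ≤ |b * Real.log x - θ| := by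
  have hx0 : (x : ℂ) ≠ 0 := ofReal_ne_zero.mpr hx.ne'
  have h1 : (x : ℂ) ^ (I * b) = Complex.exp ((b * Real.log x : ℝ) * I) := by
    rw [Complex.cpow_def_of_ne_zero hx0, ← Complex.ofReal_log hx.le]
    congr 1
    push_cast
    ring
  have h2 : Complex.exp ((b * Real.log x : ℝ) * I) - Complex.exp (θ * I) =
      Complex.exp (θ * I) * (Complex.exp (I * (b * Real.log x - θ : ℝ)) - 1) := by
    rw [mul_sub, mul_one, ← Complex.exp_add]
    congr 2
    push_cast
    ring
  rw [h1, h2, norm_mul, Complex.norm_exp_ofReal_mul_I, one_mul]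
  exact (Real.norm_exp_I_mul_ofReal_sub_one_le).trans (by rw [Real.norm_eq_abs])

/-- `log P₄ = 𝓛⁹ − 2𝓛^{1.1} + 519 log 𝓛` (`P₄ = PT⁻²t₀`, `P = e^{𝓛⁹}`, `T = e^{𝓛^{1.1}}`, `t₀ = 𝓛⁵¹⁹`).
[cite: Zhang2022LandauSiegel, §6 p.30] -/
theorem log_P4 (hℓ : 0 < ell D) :
    Real.log (P4 D) = ell D ^ 9 - 2 * ell D ^ (1.1 : ℝ) + 519 * Real.log (ell D) := by
  have hP : 0 < bigP D := Real.exp_pos _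
  have hT : 0 < bigT D := Real.exp_pos _
  have ht : 0 < t0 D := pow_pos hℓ _
  rw [P4, Real.log_mul (div_pos hP (pow_pos hT 2)).ne' ht.ne', Real.log_div hP.ne' (pow_pos hT 2).ne',
    Real.log_pow, bigP, Real.log_exp, bigT, Real.log_exp, t0, Real.log_pow]
  push_cast
  ring

/-- `P₄ > 0`. [cite: Zhang2022LandauSiegel, §6 p.30] -/
theorem P4_pos (hℓ : 0 < ell D) : 0 < P4 D := by
  rw [P4]; exact mul_pos (div_pos (Real.exp_pos _) (pow_pos (Real.exp_pos _) _)) (pow_pos hℓ _)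

/-- **`P₄^{β₂−β₁} = −1 + O(𝓛⁻⁶)`**: for `𝓛 ≥ 1`,
`‖P₄^{β₂−β₁} + 1‖ ≤ (521π + 3654π²|c′|)𝓛⁻⁶` (`β₂ − β₁ = iα(1+7c′α𝓛)`,
`|α log P₄ − π| = α|−2𝓛^{1.1} + 519 log 𝓛| ≤ 521π𝓛⁻⁷`). [cite: Zhang2022LandauSiegel, §16 p.95] -/
theorem norm_P4_cpow_add_one_le (hℓ : 1 ≤ ell D) :
    ‖((P4 D : ℝ) : ℂ) ^ (beta2 c' D - beta1 c' D) - (-1)‖ ≤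
      (521 * π + 3654 * π ^ 2 * |c'|) * (ell D ^ 6)⁻¹ := by
  have hℓ0 : 0 < ell D := by linarith
  have hα9 : alpha D * ell D ^ 9 = π := alpha_mul_ell_pow_nine hℓ0
  have hα : 0 < alpha D := alpha_pos_of_ell_pos hℓ0
  obtain ⟨-, h21, -⟩ := beta2_eq_I_mul c' D
  set b : ℝ := alpha D * (1 + 7 * c' * alpha D * ell D) with hb
  rw [h21, show (-1 : ℂ) = Complex.exp (π * I) by rw [Complex.exp_pi_mul_I]]
  refine (norm_cpow_I_mul_sub_exp_le (P4_pos hℓ0) b π).trans ?_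
  rw [log_P4 hℓ0]
  -- sizes
  have hlog : 0 ≤ Real.log (ell D) ∧ Real.log (ell D) ≤ ell D :=
    ⟨Real.log_nonneg hℓ, (Real.log_le_sub_one_of_pos hℓ0).trans (by linarith)⟩
  have hr11 : ell D ^ (1.1 : ℝ) ≤ ell D ^ 2 := by
    have := Real.rpow_le_rpow_of_exponent_le hℓ (show (1.1 : ℝ) ≤ 2 by norm_num)
    rwa [show ((2 : ℝ)) = ((2 : ℕ) : ℝ) by norm_num, Real.rpow_natCast] at this
  have hr11' : 0 ≤ ell D ^ (1.1 : ℝ) := by positivity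
  -- `α log P₄ − π = α(−2𝓛^{1.1} + 519 log 𝓛)`
  have hmain : alpha D * (ell D ^ 9 - 2 * ell D ^ (1.1 : ℝ) + 519 * Real.log (ell D)) - π =
      alpha D * (-2 * ell D ^ (1.1 : ℝ) + 519 * Real.log (ell D)) := by rw [← hα9]; ring
  have hA : |alpha D * (-2 * ell D ^ (1.1 : ℝ) + 519 * Real.log (ell D))| ≤ 521 * π * (ell D ^ 7)⁻¹ := by
    rw [abs_mul, abs_of_pos hα]
    have h1 : |(-2 * ell D ^ (1.1 : ℝ) + 519 * Real.log (ell D))| ≤ 521 * ell D ^ 2 := by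
      rw [abs_le]; constructor <;> nlinarith [hlog.1, hlog.2, sq_nonneg (ell D)]
    have h7 : alpha D * ell D ^ 2 = π * (ell D ^ 7)⁻¹ := by
      rw [← hα9]; field_simp
    calc alpha D * |(-2 * ell D ^ (1.1 : ℝ) + 519 * Real.log (ell D))|
        ≤ alpha D * (521 * ell D ^ 2) := by gcongr
      _ = 521 * π * (ell D ^ 7)⁻¹ := by rw [show alpha D * (521 * ell D ^ 2) = 521 * (alpha D * ell D ^ 2) by ring, h7]; ring
  have hB : |alpha D * (ell D ^ 9 - 2 * ell D ^ (1.1 : ℝ) + 519 * Real.log (ell D))| ≤ 522 * π := by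
    have : alpha D * (ell D ^ 9 - 2 * ell D ^ (1.1 : ℝ) + 519 * Real.log (ell D)) =
        π + alpha D * (-2 * ell D ^ (1.1 : ℝ) + 519 * Real.log (ell D)) := by linarith [hmain]
    rw [this]
    refine (abs_add_le _ _).trans ?_
    rw [abs_of_pos Real.pi_pos]
    have h7 : (ell D ^ 7)⁻¹ ≤ 1 := inv_le_one_of_one_le₀ (one_le_pow₀ hℓ)
    nlinarith [hA, Real.pi_pos]
  -- assemble `b log P₄ − π`
  have hexp : b * (ell D ^ 9 - 2 * ell D ^ (1.1 : ℝ) + 519 * Real.log (ell D)) - π =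
      alpha D * (-2 * ell D ^ (1.1 : ℝ) + 519 * Real.log (ell D)) +
        7 * c' * (alpha D * ell D) *
          (alpha D * (ell D ^ 9 - 2 * ell D ^ (1.1 : ℝ) + 519 * Real.log (ell D))) := by
    rw [hb, ← hα9]; ring
  rw [hexp]
  refine (abs_add_le _ _).trans ?_
  have hαℓ : alpha D * ell D = π * (ell D ^ 8)⁻¹ := by rw [← hα9]; field_simp
  have h78 : (ell D ^ 7)⁻¹ ≤ (ell D ^ 6)⁻¹ := by
    rw [inv_le_inv₀ (by positivity) (by positivity)]
    exact pow_le_pow_right₀ hℓ (by norm_num)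
  have h86 : (ell D ^ 8)⁻¹ ≤ (ell D ^ 6)⁻¹ := by
    rw [inv_le_inv₀ (by positivity) (by positivity)]
    exact pow_le_pow_right₀ hℓ (by norm_num)
  have hC : |7 * c' * (alpha D * ell D) *
      (alpha D * (ell D ^ 9 - 2 * ell D ^ (1.1 : ℝ) + 519 * Real.log (ell D)))| ≤
      3654 * π ^ 2 * |c'| * (ell D ^ 8)⁻¹ := by
    rw [abs_mul, abs_mul, abs_mul, hαℓ, abs_of_pos (by positivity : (0:ℝ) < π * (ell D ^ 8)⁻¹),
      show |(7:ℝ)| = 7 by norm_num]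
    have : |c'| * (π * (ell D ^ 8)⁻¹) *
        |alpha D * (ell D ^ 9 - 2 * ell D ^ (1.1 : ℝ) + 519 * Real.log (ell D))| ≤
        |c'| * (π * (ell D ^ 8)⁻¹) * (522 * π) :=
      mul_le_mul_of_nonneg_left hB (by positivity)
    nlinarith [this]
  calc |alpha D * (-2 * ell D ^ (1.1 : ℝ) + 519 * Real.log (ell D))| +
        |7 * c' * (alpha D * ell D) *
          (alpha D * (ell D ^ 9 - 2 * ell D ^ (1.1 : ℝ) + 519 * Real.log (ell D)))|
      ≤ 521 * π * (ell D ^ 7)⁻¹ + 3654 * π ^ 2 * |c'| * (ell D ^ 8)⁻¹ := add_le_add hA hC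
    _ ≤ 521 * π * (ell D ^ 6)⁻¹ + 3654 * π ^ 2 * |c'| * (ell D ^ 6)⁻¹ := by gcongr
    _ = (521 * π + 3654 * π ^ 2 * |c'|) * (ell D ^ 6)⁻¹ := by ring

/-- **`ω₁(γ)/γ` against `1/γ`** for purely imaginary `γ = ib` (`b` real; `γ = β₂ − β₁`):
`ω₁(γ) = exp(−b²/(4Λ)) ∈ (0,1]`, so `‖ω₁(γ)/γ − γ⁻¹‖ ≤ (|γ|²/(4Λ))·‖γ⁻¹‖` (`Λ = 𝓛³⁰ > 0`).
[cite: Zhang2022LandauSiegel, §4 (4.1)] -/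
theorem norm_omega1_div_sub_inv_le {Λ b : ℝ} (hΛ : 0 < Λ) :
    ‖GaussWeight.omega1 Λ (I * b) / (I * b) - (I * b)⁻¹‖ ≤
      ‖I * (b : ℂ)‖ ^ 2 / (4 * Λ) * ‖(I * (b : ℂ))⁻¹‖ := by
  have hnb : ‖I * (b : ℂ)‖ ^ 2 = b ^ 2 := by
    rw [norm_mul, Complex.norm_I, one_mul, Complex.norm_real, Real.norm_eq_abs, sq_abs]
  have hω : GaussWeight.omega1 Λ (I * b) = ((Real.exp (-(b ^ 2 / (4 * Λ))) : ℝ) : ℂ) := by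
    rw [GaussWeight.omega1, Complex.ofReal_exp]
    congr 1
    push_cast
    rw [mul_pow, Complex.I_sq]
    ring
  have hid : GaussWeight.omega1 Λ (I * b) / (I * b) - (I * b)⁻¹ =
      (GaussWeight.omega1 Λ (I * b) - 1) * (I * (b : ℂ))⁻¹ := by ring
  rw [hid, norm_mul, hω, ← Complex.ofReal_one, ← Complex.ofReal_sub, Complex.norm_real, hnb]
  gcongr
  have ht : 0 ≤ b ^ 2 / (4 * Λ) := by positivity
  rw [Real.norm_eq_abs, abs_sub_comm,
    abs_of_nonneg (by linarith [Real.exp_le_one_iff.mpr (neg_nonpos.mpr ht)])]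
  linarith [Real.add_one_le_exp (-(b ^ 2 / (4 * Λ)))]

end PowAndWeight


/-! ### Small numeric facts about `α = π𝓛⁻⁹` -/

section AlphaFacts

variable (c' : ℝ) {D : ℕ}

/-- `α ≤ π/𝓛` and `α𝓛 ≤ π/𝓛` for `𝓛 ≥ 1`. [cite: Zhang2022LandauSiegel, §2 (2.10)] -/
theorem alpha_le_pi_div (hℓ1 : 1 ≤ ell D) :
    alpha D ≤ π / ell D ∧ alpha D * ell D ≤ π / ell D := by
  have hℓ0 : 0 < ell D := by linarith
  have hα9 := alpha_mul_ell_pow_nine (D := D) hℓ0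
  have hα := alpha_pos_of_ell_pos (D := D) hℓ0
  constructor
  · rw [le_div_iff₀ hℓ0, ← hα9]
    exact mul_le_mul_of_nonneg_left (le_self_pow₀ hℓ1 (by norm_num)) hα.le
  · rw [le_div_iff₀ hℓ0, ← hα9]
    have h29 : ell D * ell D ≤ ell D ^ 9 := by
      calc ell D * ell D = ell D ^ 2 := by ring
        _ ≤ ell D ^ 9 := pow_le_pow_right₀ hℓ1 (by norm_num)
    calc alpha D * ell D * ell D = alpha D * (ell D * ell D) := by ring
      _ ≤ alpha D * ell D ^ 9 := mul_le_mul_of_nonneg_left h29 hα.le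

/-- For `𝓛 ≥ 14π|c′| + 1`: `|c′|α𝓛 ≤ 1/14` and `5|c′|α𝓛 ≤ 1/2`. [cite: Zhang2022LandauSiegel, §2 (2.13)] -/
theorem c_alpha_ell_small (hℓ1 : 1 ≤ ell D) (hℓc : 14 * π * |c'| + 1 ≤ ell D) :
    |c'| * (alpha D * ell D) ≤ 1 / 14 ∧ 5 * |c'| * (alpha D * ell D) ≤ 1 / 2 := by
  have hℓ0 : 0 < ell D := by linarith
  have hαℓ := (alpha_le_pi_div (D := D) hℓ1).2
  have h1 : |c'| * (π / ell D) ≤ 1 / 14 := by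
    rw [mul_div_assoc', div_le_iff₀ hℓ0]; linarith
  have h14 := le_trans (mul_le_mul_of_nonneg_left hαℓ (abs_nonneg _)) h1
  exact ⟨h14, by linarith [abs_nonneg c']⟩

/-- For `𝓛 ≥ max(3π/r, 12Mπ) + 1`: `3α < r`, `6Mα ≤ 1/2`, `4Mα ≤ 1/2`.
[cite: Zhang2022LandauSiegel, §2 (2.10)] -/
theorem alpha_small_rM {r M : ℝ} (hr : 0 < r) (hM : 0 ≤ M) (hℓ1 : 1 ≤ ell D)
    (hℓr : 3 * π / r + 1 ≤ ell D) (hℓM : 12 * M * π + 1 ≤ ell D) :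
    3 * alpha D < r ∧ 6 * M * alpha D ≤ 1 / 2 ∧ 4 * M * alpha D ≤ 1 / 2 := by
  have hℓ0 : 0 < ell D := by linarith
  have hα := alpha_pos_of_ell_pos (D := D) hℓ0
  have hα_le := (alpha_le_pi_div (D := D) hℓ1).1
  have h2 : alpha D * ell D ≤ π := by rwa [le_div_iff₀ hℓ0] at hα_le
  refine ⟨?_, ?_, ?_⟩
  · have h1 : 3 * π < r * ell D := by
      have : 3 * π = r * (3 * π / r) := by field_simp
      rw [this]; exact mul_lt_mul_of_pos_left (by linarith) hr
    nlinarith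
  · have h1 : 6 * M * (π / ell D) ≤ 1 / 2 := by
      rw [mul_div_assoc', div_le_iff₀ hℓ0]; linarith
    exact le_trans (mul_le_mul_of_nonneg_left hα_le (by positivity)) h1
  · have h1 : 6 * M * (π / ell D) ≤ 1 / 2 := by
      rw [mul_div_assoc', div_le_iff₀ hℓ0]; linarith
    have := le_trans (mul_le_mul_of_nonneg_left hα_le (by positivity)) h1
    nlinarith

/-- For `𝓛 ≥ 32eC₅₈/π + 1`: `C₅₈𝓛⁻¹⁵ ≤ α/(32e)`, hence `≤ |β||L′|/4` whenever
`|β| ≥ α/2` and `|L′| ≥ (4e)⁻¹`. [cite: Zhang2022LandauSiegel, §5 Lemma 5.8] -/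
theorem lemma58_error_small {C₅₈ nβ nL : ℝ} (hℓ1 : 1 ≤ ell D)
    (hℓE : 32 * Real.exp 1 * C₅₈ / π + 1 ≤ ell D) (hnβ : alpha D / 2 ≤ nβ)
    (hnL : 1 / (4 * Real.exp 1) ≤ nL) : C₅₈ / ell D ^ 15 ≤ nβ * nL / 4 := by
  have hℓ0 : 0 < ell D := by linarith
  have hπ := Real.pi_pos
  have hα9 := alpha_mul_ell_pow_nine (D := D) hℓ0
  have hα := alpha_pos_of_ell_pos (D := D) hℓ0
  have hαeq : alpha D = π / ell D ^ 9 := by rw [← hα9]; field_simp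
  have hnβ0 : 0 ≤ nβ := by linarith
  have hℓ6 : ell D ≤ ell D ^ 6 := le_self_pow₀ hℓ1 (by norm_num)
  have h32 : 32 * Real.exp 1 * C₅₈ ≤ π * ell D ^ 6 := by
    have h := (div_le_iff₀ hπ).mp (by linarith : 32 * Real.exp 1 * C₅₈ / π ≤ ell D ^ 6)
    linarith
  have h1 : C₅₈ / ell D ^ 15 ≤ alpha D / (32 * Real.exp 1) := by
    rw [hαeq, div_div, div_le_div_iff₀ (by positivity) (by positivity)]
    calc C₅₈ * (ell D ^ 9 * (32 * Real.exp 1)) = 32 * Real.exp 1 * C₅₈ * ell D ^ 9 := by ring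
      _ ≤ π * ell D ^ 6 * ell D ^ 9 := by gcongr
      _ = π * ell D ^ 15 := by ring
  calc C₅₈ / ell D ^ 15 ≤ alpha D / (32 * Real.exp 1) := h1
    _ = (alpha D / 2) * (1 / (4 * Real.exp 1)) / 4 := by ring
    _ ≤ nβ * nL / 4 := by gcongr

/-- For `𝓛 ≥ 3` (`α ≤ 1`) and `|γ| ≤ 2α`: `|γ|²/(4𝓛³⁰) ≤ 𝓛⁻⁶ ≤ 1`.
[cite: Zhang2022LandauSiegel, §4 (4.1)] -/
theorem weight_error_small {nγ : ℝ} (hℓ3 : 3 ≤ ell D) (hγu : nγ ≤ 2 * alpha D) (hγ0 : 0 ≤ nγ) :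
    nγ ^ 2 / (4 * ell D ^ 30) ≤ (ell D ^ 6)⁻¹ ∧ nγ ^ 2 / (4 * ell D ^ 30) ≤ 1 := by
  have hℓ1 : 1 ≤ ell D := by linarith
  have hℓ0 : 0 < ell D := by linarith
  -- `α ≤ 1` for `𝓛 ≥ 3` (the landed `ResidueValues.alpha_le_one`, re-derived inline)
  have hα1 : alpha D ≤ 1 := by
    have hα9 := alpha_mul_ell_pow_nine (D := D) hℓ0
    have h39 : (3 : ℝ) ^ 9 ≤ ell D ^ 9 := pow_le_pow_left₀ (by norm_num) hℓ3 9
    have hπ9 : π ≤ ell D ^ 9 := by linarith [Real.pi_lt_four]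
    have : alpha D = π / ell D ^ 9 := by rw [← hα9]; field_simp
    rw [this]; exact div_le_one_of_le₀ hπ9 (by positivity)
  have h1 : nγ ≤ 2 := by linarith
  have h2 : nγ ^ 2 ≤ 4 := by nlinarith
  have hℓ630 : ell D ^ 6 ≤ ell D ^ 30 := pow_le_pow_right₀ hℓ1 (by norm_num)
  have hv : nγ ^ 2 / (4 * ell D ^ 30) ≤ (ell D ^ 6)⁻¹ := by
    calc nγ ^ 2 / (4 * ell D ^ 30) ≤ 4 / (4 * ell D ^ 30) := by gcongr
      _ = (ell D ^ 30)⁻¹ := by field_simp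
      _ ≤ (ell D ^ 6)⁻¹ := inv_anti₀ (by positivity) hℓ630
  exact ⟨hv, hv.trans (inv_le_one_of_one_le₀ (one_le_pow₀ hℓ1))⟩

end AlphaFacts

end Literature.NumberTheory.LFunctions.Zhang2022.Skeleton
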